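import Summits.NavierStokesRegularity.NavierStokesRegularity.Theorems.EulerZoomLiouvillePowerGaugeEulerLiouvilleNeedleLogCapacity

/-!
# t36 (sequel) — planar LOG-CAPACITY lemma: area-robust annulus form, disc forms, thin-core radius bounds

Second half of nsreg-p2 g31's plate `…NeedleLogCapacity` v1.1 (sha16 cd96c19ff2dc6a7d), split for the gate's
400-line limit (nsreg-C26-p1 g3 lands, author nsreg-p2 g31).  See the first file for the setting, the ray
estimates and the concentric annulus lemma `logCapacity_annulus_lintegral` (`2π(M−m)²/log(δ/w)`,
[cite: Mazja1985, §2.2.4 (1)]).  Here: `logCapacity_annulus_lintegral_of_area` (superlevel set of at most half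
the annulus area ⇒ constant `π(M−m)²/log(δ/w)`; length–area method, folklore), `logCapacity_disc`,
`logCapacity_disc_of_area`, `logCapacity_disc_of_contDiff`, `radius_le_of_capacity`, `core_radius_le`
(`w ≤ δ·exp(−2π(M−m)²/𝓔)`), `core_radius_le_of_area` (`w ≤ δ·exp(−π(M−m)²/𝓔)`).  Declaration names = plate;
statements = the plate's with the abbreviation `annulus w δ = {z | w ≤ ‖z‖ ∧ ‖z‖ ≤ δ}` spelled out.
WHAT THIS IS NOT: pure real analysis in the plane; no Euler/NS statement; not crux E.
-/

noncomputable section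

set_option linter.dupNamespace false

open MeasureTheory Set Filter Topology
open scoped Real ENNReal

namespace Summit.NavierStokesRegularity.NavierStokesRegularity.Theorems.PowerGaugeEulerLiouville.NeedleLogCapacity

/-- **Planar log-capacity lemma, AREA-ROBUST form** (what a needle cross-section actually supplies).  If `f : ℂ → ℝ` is
`C¹` on the closed {z : ℂ | `w ≤ ‖z‖ ∧ ‖z‖ ≤ ≤} ‖z‖ ≤ δ` (`0 < w < δ`), `f ≥ M` on the circle `‖z‖ = w`, `m ≤ M`, and the superlevel set
`{f > m}` occupies AT MOST HALF of the open annulus, `|{w < ‖z‖ < δ, f z > m}| ≤ π(δ² − w²)/2`, then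
`∫_{w<‖z‖<δ} ‖f'‖² ≥ π(M − m)²/log(δ/w)` (half the concentric constant; nothing is asked on any circle).
PROOF: a ray either meets `{f ≤ m}` (escape ray estimate) or is BLOCKED (lies in `{f > m}`); blocked rays carry
polar area `∫_w^δ s ds = (δ² − w²)/2` each, so their directions have measure `≤ π`.  [folklore: length–area method] -/
theorem logCapacity_annulus_lintegral_of_area {f : ℂ → ℝ} {f' : ℂ → ℂ →L[ℝ] ℝ} {w δ m M : ℝ}
    (hw : 0 < w) (hwδ : w < δ)
    (hf : ∀ z ∈ {z : ℂ | w ≤ ‖z‖ ∧ ‖z‖ ≤ δ}, HasFDerivAt f (f' z) z) (hf' : ContinuousOn f' ({z : ℂ | w ≤ ‖z‖ ∧ ‖z‖ ≤ δ}))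
    (hM : ∀ z : ℂ, ‖z‖ = w → M ≤ f z) (hmM : m ≤ M)
    (harea : volume {z : ℂ | (w < ‖z‖ ∧ ‖z‖ < δ) ∧ m < f z} ≤ ENNReal.ofReal (π * (δ ^ 2 - w ^ 2) / 2)) :
    ENNReal.ofReal (π * (M - m) ^ 2 / Real.log (δ / w)) ≤
      ∫⁻ z in {z : ℂ | w < ‖z‖ ∧ ‖z‖ < δ}, ‖f' z‖ₑ ^ 2 := by
  have hδ : 0 < δ := hw.trans hwδ
  have hL : 0 < Real.log (δ / w) := Real.log_pos ((one_lt_div hw).mpr hwδ)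
  set q : ℝ := (M - m) ^ 2 / Real.log (δ / w) with hq_def
  have hq : 0 ≤ q := div_nonneg (sq_nonneg _) hL.le
  have hsq : 0 < δ ^ 2 - w ^ 2 := by nlinarith
  set a : ℝ := (δ ^ 2 - w ^ 2) / 2 with ha_def
  have ha : 0 < a := by rw [ha_def]; positivity
  set S : Set ℂ := {z : ℂ | w < ‖z‖ ∧ ‖z‖ < δ} with hS_def
  set U : Set ℂ := {z : ℂ | (w < ‖z‖ ∧ ‖z‖ < δ) ∧ m < f z} with hU_def
  -- `U` is open (hence measurable): `f` is continuous on the open annulus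
  have hS_open : IsOpen S := by
    have : S = Metric.ball (0 : ℂ) δ \ Metric.closedBall 0 w := by
      ext z
      simp only [hS_def, mem_setOf_eq, Set.mem_sdiff, mem_ball_zero_iff, mem_closedBall_zero_iff, not_le]
      exact and_comm
    rw [this]
    exact Metric.isOpen_ball.sdiff Metric.isClosed_closedBall
  have hS_sub : S ⊆ {z : ℂ | w ≤ ‖z‖ ∧ ‖z‖ ≤ δ} := fun z hz => ⟨hz.1.le, hz.2.le⟩
  have hf_cont : ContinuousOn f S := fun z hz => (hf z (hS_sub hz)).continuousAt.continuousWithinAt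
  have hU_open : IsOpen U := by
    show IsOpen (S ∩ f ⁻¹' Ioi m)
    exact hf_cont.isOpen_inter_preimage hS_open isOpen_Ioi
  have hU : MeasurableSet U := hU_open.measurableSet
  -- the blocked-ray detector `H(s, θ) = s · 1_U(s · ((Real.cos θ : ℂ) + (Real.sin θ : ℂ) * Complex.I))` on the polar box, and its θ-marginal `J`
  have hray_cont : Continuous fun p : ℝ × ℝ => (p.1 : ℂ) * ((Real.cos p.2 : ℂ) + (Real.sin p.2 : ℂ) * Complex.I) :=
    (Complex.continuous_ofReal.comp continuous_fst).mul (continuous_dir.comp continuous_snd)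
  set H : ℝ × ℝ → ℝ≥0∞ :=
    fun p => ENNReal.ofReal p.1 * U.indicator (fun _ => (1 : ℝ≥0∞)) ((p.1 : ℂ) * ((Real.cos p.2 : ℂ) + (Real.sin p.2 : ℂ) * Complex.I)) with hH_def
  have hHm : Measurable H :=
    (ENNReal.measurable_ofReal.comp measurable_fst).mul
      ((measurable_const.indicator hU).comp hray_cont.measurable)
  have hJm : Measurable fun θ : ℝ => ∫⁻ s in Ioo w δ, H (s, θ) := hHm.lintegral_prod_left'
  -- (i) the θ-integral of `J` is at most the area of `U` (polar coordinates, upper-bound direction)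
  have hJ_le : ∫⁻ θ in Ioo (-π) π, ∫⁻ s in Ioo w δ, H (s, θ) ≤ volume U := by
    have hBx_sub : Ioo w δ ×ˢ Ioo (-π) π ⊆ polarCoord.target := by
      rintro ⟨s, θ⟩ ⟨hs, hθ⟩
      rw [polarCoord_target]
      exact ⟨hw.trans hs.1, hθ⟩
    have hT : ∫⁻ p in Ioo w δ ×ˢ Ioo (-π) π, H p = ∫⁻ θ in Ioo (-π) π, ∫⁻ s in Ioo w δ, H (s, θ) := by
      rw [Measure.volume_eq_prod, ← Measure.prod_restrict, lintegral_prod_symm H hHm.aemeasurable]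
    calc ∫⁻ θ in Ioo (-π) π, ∫⁻ s in Ioo w δ, H (s, θ)
        = ∫⁻ p in Ioo w δ ×ˢ Ioo (-π) π, H p := hT.symm
      _ ≤ ∫⁻ p in polarCoord.target, H p := lintegral_mono_set hBx_sub
      _ = ∫⁻ p in polarCoord.target,
            ENNReal.ofReal p.1 • U.indicator (fun _ => (1 : ℝ≥0∞)) (Complex.polarCoord.symm p) := by
          simp only [hH_def, polarCoord_symm_eq_ray, smul_eq_mul]
      _ = ∫⁻ z, U.indicator (fun _ => (1 : ℝ≥0∞)) z := Complex.lintegral_comp_polarCoord_symm _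
      _ = volume U := by rw [lintegral_indicator hU, setLIntegral_one]
  -- (ii) pointwise in θ: either the ray escapes (ray estimate) or it is blocked (`J θ = a`)
  set K : ℝ≥0∞ := ENNReal.ofReal (q / a) with hK_def
  have hpt : ∀ θ : ℝ, ENNReal.ofReal q ≤
      (∫⁻ s in Ioo w δ, ENNReal.ofReal (s * ‖f' ((s : ℂ) * ((Real.cos θ : ℂ) + (Real.sin θ : ℂ) * Complex.I))‖ ^ 2)) + K * ∫⁻ s in Ioo w δ, H (s, θ) := by
    intro θ
    by_cases hblk : ∀ s ∈ Ioo w δ, m < f ((s : ℂ) * ((Real.cos θ : ℂ) + (Real.sin θ : ℂ) * Complex.I))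
    · -- blocked ray
      have hcongr : ∫⁻ s in Ioo w δ, H (s, θ) = ∫⁻ s in Ioo w δ, ENNReal.ofReal s := by
        refine setLIntegral_congr_fun measurableSet_Ioo fun s hs => ?_
        have hmem : (s : ℂ) * ((Real.cos θ : ℂ) + (Real.sin θ : ℂ) * Complex.I) ∈ U := by
          refine ⟨⟨?_, ?_⟩, hblk s hs⟩ <;> rw [norm_ray (norm_dir θ) (hw.trans hs.1).le]
          exacts [hs.1, hs.2]
        simp only [hH_def, indicator_of_mem hmem, mul_one]
      have hint : IntegrableOn (fun s : ℝ => s) (Ioo w δ) :=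
        (continuous_id.integrableOn_Icc).mono_set Ioo_subset_Icc_self
      have hnn : 0 ≤ᵐ[volume.restrict (Ioo w δ)] fun s : ℝ => s := by
        filter_upwards [ae_restrict_mem measurableSet_Ioo] with s hs
        exact (hw.trans hs.1).le
      have hid : ∫ s in Ioo w δ, s = a := by
        rw [← integral_Ioc_eq_integral_Ioo, ← intervalIntegral.integral_of_le hwδ.le, integral_id]
      have hJ : ∫⁻ s in Ioo w δ, H (s, θ) = ENNReal.ofReal a := by
        calc ∫⁻ s in Ioo w δ, H (s, θ) = ∫⁻ s in Ioo w δ, ENNReal.ofReal s := hcongr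
          _ = ENNReal.ofReal (∫ s in Ioo w δ, s) := (ofReal_integral_eq_lintegral_ofReal hint hnn).symm
          _ = ENNReal.ofReal a := by rw [hid]
      calc ENNReal.ofReal q = K * ENNReal.ofReal a := by
            rw [hK_def, ← ENNReal.ofReal_mul (div_nonneg hq ha.le)]
            congr 1
            field_simp
        _ = K * ∫⁻ s in Ioo w δ, H (s, θ) := by rw [hJ]
        _ ≤ _ := le_add_self
    · -- escaping ray
      push Not at hblk
      obtain ⟨s, hs, hfs⟩ := hblk
      exact le_add_right (rayLIntegral_ge hw hwδ hf hf' θ (hM _ (norm_ray (norm_dir θ) hw.le))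
        ⟨s, Ioo_subset_Icc_self hs, hfs⟩ hmM)
  -- (iii) integrate over `θ ∈ ]−π, π[`
  have hint_θ : (∫⁻ _θ in Ioo (-π) π, ENNReal.ofReal q) ≤
      (∫⁻ θ in Ioo (-π) π, ∫⁻ s in Ioo w δ, ENNReal.ofReal (s * ‖f' ((s : ℂ) * ((Real.cos θ : ℂ) + (Real.sin θ : ℂ) * Complex.I))‖ ^ 2)) +
        K * volume U := by
    calc (∫⁻ _θ in Ioo (-π) π, ENNReal.ofReal q)
        ≤ ∫⁻ θ in Ioo (-π) π, ((∫⁻ s in Ioo w δ, ENNReal.ofReal (s * ‖f' ((s : ℂ) * ((Real.cos θ : ℂ) + (Real.sin θ : ℂ) * Complex.I))‖ ^ 2)) +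
            K * ∫⁻ s in Ioo w δ, H (s, θ)) := lintegral_mono hpt
      _ = (∫⁻ θ in Ioo (-π) π, ∫⁻ s in Ioo w δ, ENNReal.ofReal (s * ‖f' ((s : ℂ) * ((Real.cos θ : ℂ) + (Real.sin θ : ℂ) * Complex.I))‖ ^ 2)) +
            K * ∫⁻ θ in Ioo (-π) π, ∫⁻ s in Ioo w δ, H (s, θ) := by
          rw [lintegral_add_right _ (hJm.const_mul K), lintegral_const_mul K hJm]
      _ ≤ _ := by gcongr
  -- (iv) arithmetic: `2π q ≤ ∫∫ + K·|U| ≤ ∫∫ + π q`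
  have hKU : K * volume U ≤ ENNReal.ofReal (π * q) := by
    calc K * volume U ≤ K * ENNReal.ofReal (π * (δ ^ 2 - w ^ 2) / 2) := by gcongr
      _ = ENNReal.ofReal (π * q) := by
          rw [hK_def, ← ENNReal.ofReal_mul (div_nonneg hq ha.le)]
          congr 1
          rw [ha_def]
          field_simp
  have hlhs : (∫⁻ _θ in Ioo (-π) π, ENNReal.ofReal q) = ENNReal.ofReal (π * q) + ENNReal.ofReal (π * q) := by
    rw [setLIntegral_const, Real.volume_Ioo, ← ENNReal.ofReal_mul hq,
      ← ENNReal.ofReal_add (mul_nonneg Real.pi_pos.le hq) (mul_nonneg Real.pi_pos.le hq)]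
    congr 1
    ring
  rw [hlhs] at hint_θ
  have hfin' : ENNReal.ofReal (π * q) + ENNReal.ofReal (π * q) ≤
      (∫⁻ θ in Ioo (-π) π, ∫⁻ s in Ioo w δ, ENNReal.ofReal (s * ‖f' ((s : ℂ) * ((Real.cos θ : ℂ) + (Real.sin θ : ℂ) * Complex.I))‖ ^ 2)) +
        ENNReal.ofReal (π * q) :=
    hint_θ.trans (by gcongr)
  have hfin := ENNReal.le_of_add_le_add_right ENNReal.ofReal_ne_top hfin'
  calc ENNReal.ofReal (π * (M - m) ^ 2 / Real.log (δ / w)) = ENNReal.ofReal (π * q) := by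
        rw [hq_def, mul_div_assoc]
    _ ≤ ∫⁻ θ in Ioo (-π) π, ∫⁻ s in Ioo w δ, ENNReal.ofReal (s * ‖f' ((s : ℂ) * ((Real.cos θ : ℂ) + (Real.sin θ : ℂ) * Complex.I))‖ ^ 2) := hfin
    _ ≤ _ := polar_lintegral_le_annulus hw hf'

/-- **Planar log-capacity lemma, closed-disc / Bochner form** (LEAD g10's (P1) verbatim).  If `f : ℂ → ℝ` is `C¹` on
the closed disc `‖z‖ ≤ δ`, `f ≥ M` on the disc `‖z‖ ≤ w` (`0 < w < δ`) and `f ≤ m ≤ M` on the circle `‖z‖ = δ`, then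
`∫_{‖z‖<δ} ‖f'‖² ≥ 2π(M − m)²/log(δ/w)`.  [folklore: capacity of an annulus] -/
theorem logCapacity_disc {f : ℂ → ℝ} {f' : ℂ → ℂ →L[ℝ] ℝ} {w δ m M : ℝ}
    (hw : 0 < w) (hwδ : w < δ)
    (hf : ∀ z ∈ Metric.closedBall (0 : ℂ) δ, HasFDerivAt f (f' z) z)
    (hf' : ContinuousOn f' (Metric.closedBall 0 δ))
    (hM : ∀ z ∈ Metric.closedBall (0 : ℂ) w, M ≤ f z) (hm : ∀ z : ℂ, ‖z‖ = δ → f z ≤ m) (hmM : m ≤ M) :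
    2 * π * (M - m) ^ 2 / Real.log (δ / w) ≤ ∫ z in Metric.ball (0 : ℂ) δ, ‖f' z‖ ^ 2 := by
  have hsub : {z : ℂ | w ≤ ‖z‖ ∧ ‖z‖ ≤ δ} ⊆ Metric.closedBall 0 δ := fun z hz => mem_closedBall_zero_iff.mpr hz.2
  have h := logCapacity_annulus_lintegral hw hwδ (fun z hz => hf z (hsub hz)) (hf'.mono hsub)
    (fun z hz => hM z (mem_closedBall_zero_iff.mpr hz.le)) hm hmM
  have hint : IntegrableOn (fun z => ‖f' z‖ ^ 2) (Metric.ball (0 : ℂ) δ) :=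
    ((hf'.norm.pow 2).integrableOn_compact (isCompact_closedBall 0 δ)).mono_set Metric.ball_subset_closedBall
  have hnn : 0 ≤ᵐ[volume.restrict (Metric.ball (0 : ℂ) δ)] fun z => ‖f' z‖ ^ 2 :=
    Eventually.of_forall fun z => sq_nonneg _
  have hS_sub : {z : ℂ | w < ‖z‖ ∧ ‖z‖ < δ} ⊆ Metric.ball 0 δ := fun z hz => mem_ball_zero_iff.mpr hz.2
  have key : ENNReal.ofReal (2 * π * (M - m) ^ 2 / Real.log (δ / w)) ≤
      ENNReal.ofReal (∫ z in Metric.ball (0 : ℂ) δ, ‖f' z‖ ^ 2) := by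
    calc ENNReal.ofReal (2 * π * (M - m) ^ 2 / Real.log (δ / w))
        ≤ ∫⁻ z in {z : ℂ | w < ‖z‖ ∧ ‖z‖ < δ}, ‖f' z‖ₑ ^ 2 := h
      _ ≤ ∫⁻ z in Metric.ball 0 δ, ‖f' z‖ₑ ^ 2 := lintegral_mono_set hS_sub
      _ = ∫⁻ z in Metric.ball 0 δ, ENNReal.ofReal (‖f' z‖ ^ 2) := by
          refine lintegral_congr fun z => ?_
          rw [← ofReal_norm, ENNReal.ofReal_pow (norm_nonneg _)]
      _ = ENNReal.ofReal (∫ z in Metric.ball (0 : ℂ) δ, ‖f' z‖ ^ 2) :=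
          (ofReal_integral_eq_lintegral_ofReal hint hnn).symm
  exact (ENNReal.ofReal_le_ofReal_iff (integral_nonneg fun z => sq_nonneg _)).mp key

/-- **Area-robust log-capacity lemma, closed-disc / Bochner form.**  `f` `C¹` on the closed disc `‖z‖ ≤ δ`, `f ≥ M` on
`‖z‖ ≤ w` (`0 < w < δ`), `m ≤ M`, and `|{‖z‖ < δ, f z > m}| ≤ π(δ² − w²)/2` ⇒ `∫_{‖z‖<δ} ‖f'‖² ≥ π(M − m)²/log(δ/w)`.
[folklore: length–area method] -/
theorem logCapacity_disc_of_area {f : ℂ → ℝ} {f' : ℂ → ℂ →L[ℝ] ℝ} {w δ m M : ℝ}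
    (hw : 0 < w) (hwδ : w < δ)
    (hf : ∀ z ∈ Metric.closedBall (0 : ℂ) δ, HasFDerivAt f (f' z) z)
    (hf' : ContinuousOn f' (Metric.closedBall 0 δ))
    (hM : ∀ z ∈ Metric.closedBall (0 : ℂ) w, M ≤ f z) (hmM : m ≤ M)
    (harea : volume {z : ℂ | ‖z‖ < δ ∧ m < f z} ≤ ENNReal.ofReal (π * (δ ^ 2 - w ^ 2) / 2)) :
    π * (M - m) ^ 2 / Real.log (δ / w) ≤ ∫ z in Metric.ball (0 : ℂ) δ, ‖f' z‖ ^ 2 := by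
  have hsub : {z : ℂ | w ≤ ‖z‖ ∧ ‖z‖ ≤ δ} ⊆ Metric.closedBall 0 δ := fun z hz => mem_closedBall_zero_iff.mpr hz.2
  have hUsub : {z : ℂ | (w < ‖z‖ ∧ ‖z‖ < δ) ∧ m < f z} ⊆ {z : ℂ | ‖z‖ < δ ∧ m < f z} :=
    fun z hz => ⟨hz.1.2, hz.2⟩
  have harea' : volume {z : ℂ | (w < ‖z‖ ∧ ‖z‖ < δ) ∧ m < f z} ≤ ENNReal.ofReal (π * (δ ^ 2 - w ^ 2) / 2) :=
    (measure_mono hUsub).trans harea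
  have h := logCapacity_annulus_lintegral_of_area hw hwδ (fun z hz => hf z (hsub hz)) (hf'.mono hsub)
    (fun z hz => hM z (mem_closedBall_zero_iff.mpr hz.le)) hmM harea'
  have hint : IntegrableOn (fun z => ‖f' z‖ ^ 2) (Metric.ball (0 : ℂ) δ) :=
    ((hf'.norm.pow 2).integrableOn_compact (isCompact_closedBall 0 δ)).mono_set Metric.ball_subset_closedBall
  have hnn : 0 ≤ᵐ[volume.restrict (Metric.ball (0 : ℂ) δ)] fun z => ‖f' z‖ ^ 2 :=
    Eventually.of_forall fun z => sq_nonneg _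
  have hS_sub : {z : ℂ | w < ‖z‖ ∧ ‖z‖ < δ} ⊆ Metric.ball 0 δ := fun z hz => mem_ball_zero_iff.mpr hz.2
  have key : ENNReal.ofReal (π * (M - m) ^ 2 / Real.log (δ / w)) ≤
      ENNReal.ofReal (∫ z in Metric.ball (0 : ℂ) δ, ‖f' z‖ ^ 2) := by
    calc ENNReal.ofReal (π * (M - m) ^ 2 / Real.log (δ / w))
        ≤ ∫⁻ z in {z : ℂ | w < ‖z‖ ∧ ‖z‖ < δ}, ‖f' z‖ₑ ^ 2 := h
      _ ≤ ∫⁻ z in Metric.ball 0 δ, ‖f' z‖ₑ ^ 2 := lintegral_mono_set hS_sub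
      _ = ∫⁻ z in Metric.ball 0 δ, ENNReal.ofReal (‖f' z‖ ^ 2) := by
          refine lintegral_congr fun z => ?_
          rw [← ofReal_norm, ENNReal.ofReal_pow (norm_nonneg _)]
      _ = ENNReal.ofReal (∫ z in Metric.ball (0 : ℂ) δ, ‖f' z‖ ^ 2) :=
          (ofReal_integral_eq_lintegral_ofReal hint hnn).symm
  exact (ENNReal.ofReal_le_ofReal_iff (integral_nonneg fun z => sq_nonneg _)).mp key

/-- **Planar log-capacity lemma for a globally `C¹` function** (the form in which it is applied to `C²` self-similar
profiles).  [folklore: capacity of an annulus] -/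
theorem logCapacity_disc_of_contDiff {f : ℂ → ℝ} {w δ m M : ℝ} (hw : 0 < w) (hwδ : w < δ)
    (hf : ContDiff ℝ 1 f)
    (hM : ∀ z ∈ Metric.closedBall (0 : ℂ) w, M ≤ f z) (hm : ∀ z : ℂ, ‖z‖ = δ → f z ≤ m) (hmM : m ≤ M) :
    2 * π * (M - m) ^ 2 / Real.log (δ / w) ≤ ∫ z in Metric.ball (0 : ℂ) δ, ‖fderiv ℝ f z‖ ^ 2 :=
  logCapacity_disc hw hwδ (fun z _ => ((hf.differentiable one_ne_zero) z).hasFDerivAt)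
    (hf.continuous_fderiv one_ne_zero).continuousOn hM hm hmM

/-- **Radius from capacity** (real arithmetic): `A/log(δ/w) ≤ 𝓔` with `A > 0`, `0 < w < δ` forces
`w ≤ δ·exp(−A/𝓔)`. -/
theorem radius_le_of_capacity {w δ A 𝓔 : ℝ} (hw : 0 < w) (hwδ : w < δ) (hA : 0 < A)
    (h : A / Real.log (δ / w) ≤ 𝓔) : w ≤ δ * Real.exp (-(A / 𝓔)) := by
  have hδ : 0 < δ := hw.trans hwδ
  have hL : 0 < Real.log (δ / w) := Real.log_pos ((one_lt_div hw).mpr hwδ)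
  have hEpos : 0 < 𝓔 := lt_of_lt_of_le (div_pos hA hL) h
  have hkey : A / 𝓔 ≤ Real.log (δ / w) := by
    rw [div_le_iff₀ hEpos]
    have := (div_le_iff₀ hL).mp h
    linarith
  have hexp : Real.exp (A / 𝓔) ≤ δ / w := by
    calc Real.exp (A / 𝓔) ≤ Real.exp (Real.log (δ / w)) := Real.exp_le_exp.mpr hkey
      _ = δ / w := Real.exp_log (div_pos hδ hw)
  rw [le_div_iff₀ hw] at hexp
  rw [Real.exp_neg]
  have hx : 0 < Real.exp (A / 𝓔) := Real.exp_pos _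
  calc w = w * Real.exp (A / 𝓔) * (Real.exp (A / 𝓔))⁻¹ := by field_simp
    _ ≤ δ * (Real.exp (A / 𝓔))⁻¹ := by
        apply mul_le_mul_of_nonneg_right _ (inv_nonneg.mpr hx.le)
        linarith [hexp]

/-- **Contrapositive «thin-core» form** (how the lemma is used on a needle cross-section): if the Dirichlet energy on
the disc is at most `𝓔`, the oscillation floor is `M − m > 0`, `f ≥ M` on `D(0,w)` and `f ≤ m` on the circle
`‖z‖ = δ`, then the core radius obeys `w ≤ δ·exp(−2π(M−m)²/𝓔)`.  [folklore] -/
theorem core_radius_le {f : ℂ → ℝ} {f' : ℂ → ℂ →L[ℝ] ℝ} {w δ m M 𝓔 : ℝ}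
    (hw : 0 < w) (hwδ : w < δ)
    (hf : ∀ z ∈ Metric.closedBall (0 : ℂ) δ, HasFDerivAt f (f' z) z)
    (hf' : ContinuousOn f' (Metric.closedBall 0 δ))
    (hM : ∀ z ∈ Metric.closedBall (0 : ℂ) w, M ≤ f z) (hm : ∀ z : ℂ, ‖z‖ = δ → f z ≤ m) (hmM : m < M)
    (hE : ∫ z in Metric.ball (0 : ℂ) δ, ‖f' z‖ ^ 2 ≤ 𝓔) :
    w ≤ δ * Real.exp (-(2 * π * (M - m) ^ 2 / 𝓔)) := by
  have hnum : 0 < 2 * π * (M - m) ^ 2 := by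
    have : 0 < (M - m) ^ 2 := pow_pos (sub_pos.mpr hmM) 2
    positivity
  exact radius_le_of_capacity hw hwδ hnum ((logCapacity_disc hw hwδ hf hf' hM hm hmM.le).trans hE)

/-- **Area-robust «thin-core» form** (the shape the needle corollary P2 consumes): if the Dirichlet energy on the disc
`‖z‖ < δ` is at most `𝓔`, `f ≥ M` on `D(0,w)`, `m < M`, and the superlevel set `{f > m}` has area at most
`π(δ² − w²)/2` in the disc, then `w ≤ δ·exp(−π(M−m)²/𝓔)`.  [folklore: length–area method] -/
theorem core_radius_le_of_area {f : ℂ → ℝ} {f' : ℂ → ℂ →L[ℝ] ℝ} {w δ m M 𝓔 : ℝ}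
    (hw : 0 < w) (hwδ : w < δ)
    (hf : ∀ z ∈ Metric.closedBall (0 : ℂ) δ, HasFDerivAt f (f' z) z)
    (hf' : ContinuousOn f' (Metric.closedBall 0 δ))
    (hM : ∀ z ∈ Metric.closedBall (0 : ℂ) w, M ≤ f z) (hmM : m < M)
    (harea : volume {z : ℂ | ‖z‖ < δ ∧ m < f z} ≤ ENNReal.ofReal (π * (δ ^ 2 - w ^ 2) / 2))
    (hE : ∫ z in Metric.ball (0 : ℂ) δ, ‖f' z‖ ^ 2 ≤ 𝓔) :
    w ≤ δ * Real.exp (-(π * (M - m) ^ 2 / 𝓔)) := by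
  have hnum : 0 < π * (M - m) ^ 2 := by
    have : 0 < (M - m) ^ 2 := pow_pos (sub_pos.mpr hmM) 2
    positivity
  exact radius_le_of_capacity hw hwδ hnum
    ((logCapacity_disc_of_area hw hwδ hf hf' hM hmM.le harea).trans hE)

end Summit.NavierStokesRegularity.NavierStokesRegularity.Theorems.PowerGaugeEulerLiouville.NeedleLogCapacity

end
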